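import Summits.KontsevichZagierPeriods.KontsevichZagierPeriods.Theorems.RootDecompWalshStrataPiSector
import Literature.NumberTheory.Transcendental.KZUnfolding

/-!
# The arc bridge `[(0,1), w/(2((1−t)²+t²))] ≡ [(0,1), w/(1+t²)]` inside the three rules

Route `RootDecompWalshStrata` (cell decomp-kz, lens 4, gen 12), support toward `QuadricSignKernel`
(item stmt-KontsevichZagierPeriods-25393).  The gen-11 descents of the solid paraboloid, the Lorentzian
cone and (after `DecompTwo`) the 4-ball end on the lineage's arc `arcRep w` (`Ball4Disc`); the
`π`-polynomial sector `Π` of `PiSector` is generated by `hqRep b = [(0,1), b/(1+t²)]`.  This file joins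
them: `of_arcRep_sub_of_hqRep_mem_relations : [arcRep w] − [hqRep w] ∈ KZ.relations`, by the chain
"cut `(0,1)` at `t = 1/2` (rule 1, the cut point is a null piece), send each half onto `(0,1)` by the
affine charts `t = (1 ± u)/2` (rule 2; `2((1−t)²+t²) = 1 + u²`), add the two copies of `hqRep (w/2)`
(rule 1)".  Also the generic one-dimensional chart lemma `cov1` and `volume_pt1`.  0 sorry.
[KontsevichZagier2001 §1.1–§1.2; this node]
-/

noncomputable section

open Literature.NumberTheory.Transcendental
open MeasureTheory Set
open MvPolynomial (aeval X C)
open Literature.ModelTheory.ExponentialFields (IsSemialgebraic isSemialgebraic_setOf_eval_pos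
  isSemialgebraic_setOf_eval_eq_zero)
open Summit.KontsevichZagierPeriods.RootDecompWalshStrata.Ball4 (ivSet isSemialgebraic_ivSet
  ivSet_subset_Icc arcRep arcRep_domain arcRep_integrand)

namespace Summit.KontsevichZagierPeriods.RootDecompWalshStrata.PiSector

/-! #### One-dimensional tools -/

/-- Points of `ℝ¹` are null. [folklore] -/
private theorem volume_pt1 (a : ℝ) : volume {x : Fin 1 → ℝ | x 0 = a} = 0 := by
  have e : {x : Fin 1 → ℝ | x 0 = a} = Set.pi univ fun _ => {a} := by
    ext x; simp [Fin.forall_fin_one]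
  rw [e, volume_pi_pi]; simp

/-- **A one-dimensional change of variables** `u ↦ φ u` between two representations of dimension `1`
with `f(u) = g(φ u)·|φ'(u)|`: rule 2, packaged. [KontsevichZagier2001 §1.2 rule (2)] -/
theorem cov1 (r r' : KZ.IntegralRep 1) (φ φ' : ℝ → ℝ)
    (hφs : IsSemialgebraicFunOn ℚ r.domain fun x => φ (x 0))
    (hd : ∀ x ∈ r.domain, HasDerivAt φ (φ' (x 0)) (x 0))
    (hinj : InjOn (fun x : Fin 1 → ℝ => (fun _ : Fin 1 => φ (x 0))) r.domain)
    (him : (fun x : Fin 1 → ℝ => (fun _ : Fin 1 => φ (x 0))) '' r.domain = r'.domain)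
    (hint : ∀ x ∈ r.domain, r.integrand x = r'.integrand (fun _ => φ (x 0)) * |φ' (x 0)|) :
    KZ.of r - KZ.of r' ∈ KZ.relations := by
  refine KZ.changeOfVariablesRel_subset_relations ⟨1, r, r', fun x _ => φ (x 0),
    fun x => LinearMap.toContinuousLinearMap (Matrix.toLin' !![φ' (x 0)]), ?_, fun x hx => ?_, hinj,
    him.symm, fun x hx => ?_, rfl⟩
  · exact IsSemialgebraicMapOn.of_forall r.isSemialgebraic_domain fun _ => hφs
  · have p0 : HasFDerivAt (fun y : Fin 1 → ℝ => y 0)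
        (ContinuousLinearMap.proj (R := ℝ) (φ := fun _ : Fin 1 => ℝ) 0) x := hasFDerivAt_apply 0 x
    have h1 := (hd x hx).comp_hasFDerivAt x p0
    have c : HasFDerivAt (fun y : Fin 1 → ℝ => φ (y 0))
        ((ContinuousLinearMap.proj 0).comp
          (LinearMap.toContinuousLinearMap (Matrix.toLin' !![φ' (x 0)]))) x := by
      refine h1.congr_fderiv ?_
      ext v; simp [dotProduct, mul_comm]
    exact (hasFDerivAt_pi'.mpr fun i => by fin_cases i; exact c).hasFDerivWithinAt
  · have : (LinearMap.toContinuousLinearMap (Matrix.toLin' !![φ' (x 0)])).det = φ' (x 0) := by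
      show LinearMap.det (Matrix.toLin' !![φ' (x 0)]) = φ' (x 0)
      rw [LinearMap.det_toLin']
      simp
    rw [this]; exact hint x hx

/-- A domain cut along two disjoint semialgebraic pieces is ONE move (rule 1). [KontsevichZagier2001 §1.2 rule (1)] -/
theorem cut_disjoint (r : KZ.IntegralRep 1) {S T : Set (Fin 1 → ℝ)} (hS : IsSemialgebraic ℚ S)
    (hT : IsSemialgebraic ℚ T) (hSr : S ⊆ r.domain) (hTr : T ⊆ r.domain) (hU : r.domain = S ∪ T)
    (hST : S ∩ T = ∅) :
    KZ.of r - KZ.of (r.restrict S hS hSr) - KZ.of (r.restrict T hT hTr) ∈ KZ.relations :=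
  KZ.domainAddRel_subset_relations ⟨1, r, r.restrict S hS hSr, r.restrict T hT hTr, hU,
    by rw [KZ.IntegralRep.domain_restrict, KZ.IntegralRep.domain_restrict, hST, measure_empty],
    fun _ _ => rfl, fun _ _ => rfl, rfl⟩

/-! #### The pieces of `(0,1)` -/

/-- The left half `(0, 1/2)`. [definition] -/
def Lset : Set (Fin 1 → ℝ) := {x | 0 < x 0 ∧ x 0 < 1 / 2}
/-- The closed-left half `[1/2, 1)`. [definition] -/
def Mset : Set (Fin 1 → ℝ) := {x | 1 / 2 ≤ x 0 ∧ x 0 < 1}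
/-- The cut point `{1/2}`. [definition] -/
def Pset : Set (Fin 1 → ℝ) := {x | x 0 = 1 / 2}
/-- The right half `(1/2, 1)`. [definition] -/
def Rset : Set (Fin 1 → ℝ) := {x | 1 / 2 < x 0 ∧ x 0 < 1}

/-- `(0, 1/2)` is `ℚ`-semialgebraic. [definition] -/
theorem sa_Lset : IsSemialgebraic ℚ Lset := by
  have e : Lset = {x | 0 < aeval x (X 0 : MvPolynomial (Fin 1) ℚ)} ∩
      {x | 0 < aeval x (C (1/2) - X 0 : MvPolynomial (Fin 1) ℚ)} := by
    ext x; simp [Lset, sub_pos]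
  rw [e]; exact (isSemialgebraic_setOf_eval_pos _).inter (isSemialgebraic_setOf_eval_pos _)

/-- Membership in the open unit interval `(0,1)`. [definition] -/
theorem mem_ivSet {x : Fin 1 → ℝ} : x ∈ ivSet ↔ 0 < x 0 ∧ x 0 < 1 := by
  simp [ivSet, Fin.forall_fin_one]

/-- `[1/2,1) = (0,1) ∖ (0,1/2)`. [folklore] -/
theorem Mset_eq_diff : Mset = ivSet \ Lset := by
  ext x
  rw [mem_sdiff, mem_ivSet]
  simp only [Mset, Lset, mem_setOf_eq, not_and, not_lt]
  constructor
  · rintro ⟨h1, h2⟩; exact ⟨⟨by linarith, h2⟩, fun _ => h1⟩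
  · rintro ⟨⟨h0, h1⟩, h2⟩; exact ⟨h2 h0, h1⟩

/-- `(1/2, 1)` is `ℚ`-semialgebraic. [definition] -/
theorem sa_Mset : IsSemialgebraic ℚ Mset := by
  rw [Mset_eq_diff]; exact isSemialgebraic_ivSet.diff sa_Lset

/-- The point `{1/2}` is `ℚ`-semialgebraic. [definition] -/
theorem sa_Pset : IsSemialgebraic ℚ Pset := by
  have e : Pset = {x | aeval x (X 0 - C (1/2) : MvPolynomial (Fin 1) ℚ) = 0} := by
    ext x; simp [Pset, sub_eq_zero]
  rw [e]; exact isSemialgebraic_setOf_eval_eq_zero _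

/-- The interval `Rset` is `ℚ`-semialgebraic. [definition] -/
theorem sa_Rset : IsSemialgebraic ℚ Rset := by
  have e : Rset = {x | 0 < aeval x (X 0 - C (1/2) : MvPolynomial (Fin 1) ℚ)} ∩
      {x | 0 < aeval x (1 - X 0 : MvPolynomial (Fin 1) ℚ)} := by
    ext x; simp [Rset, sub_pos]
  rw [e]; exact (isSemialgebraic_setOf_eval_pos _).inter (isSemialgebraic_setOf_eval_pos _)

/-- `(0, 1/2) ⊆ (0, 1)`. [definition] -/
theorem Lset_subset : Lset ⊆ ivSet := fun x hx => mem_ivSet.2 ⟨hx.1, by linarith [hx.2]⟩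
/-- `(1/2, 1) ⊆ (0, 1)`. [definition] -/
theorem Mset_subset : Mset ⊆ ivSet := fun x hx => mem_ivSet.2 ⟨by linarith [hx.1], hx.2⟩
/-- `{1/2} ⊆ (0, 1)`. [definition] -/
theorem Pset_subset : Pset ⊆ ivSet := fun x hx => mem_ivSet.2 ⟨by rw [hx]; norm_num, by rw [hx]; norm_num⟩
/-- `Rset ⊆ (0, 1)`. [definition] -/
theorem Rset_subset : Rset ⊆ ivSet := fun x hx => mem_ivSet.2 ⟨by linarith [hx.1], hx.2⟩

/-- The pieces of the arc. [definition] -/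
def arcL (w : ℚ) : KZ.IntegralRep 1 := (arcRep w).restrict Lset sa_Lset Lset_subset
/-- The piece `[1/2,1)` of the arc. [definition] -/
def arcM (w : ℚ) : KZ.IntegralRep 1 := (arcRep w).restrict Mset sa_Mset Mset_subset
/-- The null piece `{1/2}` of the arc. [definition] -/
def arcP (w : ℚ) : KZ.IntegralRep 1 := (arcM w).restrict Pset sa_Pset fun x hx => ⟨by rw [hx], by rw [hx]; norm_num⟩
/-- The piece `(1/2,1)` of the arc. [definition] -/
def arcR (w : ℚ) : KZ.IntegralRep 1 := (arcM w).restrict Rset sa_Rset fun _ hx => ⟨hx.1.le, hx.2⟩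

/-- Cut 1: `(0,1) = (0,1/2) ⊔ [1/2,1)`. [KontsevichZagier2001 §1.2 rule (1)] -/
theorem cut1 (w : ℚ) : KZ.of (arcRep w) - KZ.of (arcL w) - KZ.of (arcM w) ∈ KZ.relations := by
  refine cut_disjoint (arcRep w) sa_Lset sa_Mset Lset_subset Mset_subset ?_ ?_
  · ext x
    rw [arcRep_domain, mem_ivSet]
    simp only [Lset, Mset, mem_union, mem_setOf_eq]
    constructor
    · rintro ⟨h0, h1⟩
      rcases lt_or_ge (x 0) (1/2) with h | h
      · exact Or.inl ⟨h0, h⟩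
      · exact Or.inr ⟨h, h1⟩
    · rintro (⟨h0, h⟩ | ⟨h, h1⟩)
      · exact ⟨h0, by linarith⟩
      · exact ⟨by linarith, h1⟩
  · exact Set.ext fun x => ⟨fun h => absurd h.1.2 (not_lt.2 h.2.1), fun h => h.elim⟩

/-- Cut 2: `[1/2,1) = {1/2} ⊔ (1/2,1)`. [KontsevichZagier2001 §1.2 rule (1)] -/
theorem cut2 (w : ℚ) : KZ.of (arcM w) - KZ.of (arcP w) - KZ.of (arcR w) ∈ KZ.relations := by
  refine cut_disjoint (arcM w) sa_Pset sa_Rset _ _ ?_ ?_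
  · ext x
    simp only [arcM, KZ.IntegralRep.domain_restrict, Mset, Pset, Rset, mem_union, mem_setOf_eq]
    constructor
    · rintro ⟨h0, h1⟩
      rcases h0.lt_or_eq with h | h
      · exact Or.inr ⟨h, h1⟩
      · exact Or.inl h.symm
    · rintro (h | ⟨h, h1⟩)
      · exact ⟨h.symm.le, by rw [h]; norm_num⟩
      · exact ⟨h.le, h1⟩
  · refine Set.ext fun x => ⟨fun h => ?_, fun h => h.elim⟩
    have h1 : x 0 = 1 / 2 := h.1
    have h2 : 1 / 2 < x 0 := h.2.1
    exact absurd h2 (by rw [h1]; exact lt_irrefl _)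

/-- The cut point is a null piece, hence a relation. [KontsevichZagier2001 §1.2] -/
theorem arcP_mem (w : ℚ) : KZ.of (arcP w) ∈ KZ.relations :=
  KZ.levelRel_le_relations (KZ.of_mem_levelRel_of_volume_eq_zero _ (volume_pt1 (1/2)))

/-- The key identity of the charts: `2((1−t)²+t²) = 1 + u²` for `t = (1 ± u)/2`. [folklore] -/
theorem two_gq_half (u : ℝ) : 2 * ((1 - (u + 1) / 2) ^ 2 + ((u + 1) / 2) ^ 2) = 1 + u ^ 2 := by ring
/-- The same identity on the other half: `t = (1 − u)/2`. [folklore] -/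
theorem two_gq_half' (u : ℝ) : 2 * ((1 - (1 - u) / 2) ^ 2 + ((1 - u) / 2) ^ 2) = 1 + u ^ 2 := by ring

/-- Right chart: `[(0,1), (w/2)/(1+u²)] ≡ [(1/2,1), w/(2((1−t)²+t²))]` by `t = (u+1)/2`. [KontsevichZagier2001 §1.2 rule (2)] -/
theorem chartR (w : ℚ) : KZ.of (hqRep (w / 2)) - KZ.of (arcR w) ∈ KZ.relations := by
  refine cov1 (hqRep (w/2)) (arcR w) (fun u => (u + 1) / 2) (fun _ => 1 / 2) ?_ (fun x _ => ?_) ?_ ?_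
    (fun x _ => ?_)
  · rw [hqRep_domain]
    exact (isSemialgebraicFunOn_aeval isSemialgebraic_ivSet
      (C (1/2) * (X 0 + 1) : MvPolynomial (Fin 1) ℚ)).congr fun x _ => by simp; ring
  · simpa using ((hasDerivAt_id (x 0)).add_const (1:ℝ)).div_const 2
  · intro x _ y _ h
    have : (x 0 + 1) / 2 = (y 0 + 1) / 2 := congrFun h 0
    funext i; fin_cases i; simp; linarith
  · apply Subset.antisymm
    · rintro _ ⟨x, hx, rfl⟩
      rw [hqRep_domain, mem_ivSet] at hx
      show (fun _ : Fin 1 => (x 0 + 1) / 2) ∈ Rset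
      exact ⟨by simp only; linarith [hx.1], by simp only; linarith [hx.2]⟩
    · intro y hy
      have hy' : 1 / 2 < y 0 ∧ y 0 < 1 := hy
      refine ⟨fun _ => 2 * y 0 - 1, ?_, ?_⟩
      · rw [hqRep_domain, mem_ivSet]; constructor <;> linarith [hy'.1, hy'.2]
      · funext i; fin_cases i; simp
  · show (hqRep (w/2)).integrand x = (arcRep w).integrand (fun _ => (x 0 + 1) / 2) * |(1:ℝ) / 2|
    rw [hqRep_integrand, arcRep_integrand, two_gq_half, abs_of_pos (by norm_num : (0:ℝ) < 1 / 2)]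
    have : (0:ℝ) < 1 + x 0 ^ 2 := by positivity
    push_cast
    field_simp

/-- Left chart: `[(0,1), (w/2)/(1+u²)] ≡ [(0,1/2), w/(2((1−t)²+t²))]` by `t = (1−u)/2`. [KontsevichZagier2001 §1.2 rule (2)] -/
theorem chartL (w : ℚ) : KZ.of (hqRep (w / 2)) - KZ.of (arcL w) ∈ KZ.relations := by
  refine cov1 (hqRep (w/2)) (arcL w) (fun u => (1 - u) / 2) (fun _ => -(1 / 2)) ?_ (fun x _ => ?_) ?_ ?_
    (fun x _ => ?_)
  · rw [hqRep_domain]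
    exact (isSemialgebraicFunOn_aeval isSemialgebraic_ivSet
      (C (1/2) * (1 - X 0) : MvPolynomial (Fin 1) ℚ)).congr fun x _ => by simp; ring
  · have h := ((hasDerivAt_id (x 0)).const_sub (1:ℝ)).div_const 2
    simpa [neg_div] using h
  · intro x _ y _ h
    have : (1 - x 0) / 2 = (1 - y 0) / 2 := congrFun h 0
    funext i; fin_cases i; simp; linarith
  · apply Subset.antisymm
    · rintro _ ⟨x, hx, rfl⟩
      rw [hqRep_domain, mem_ivSet] at hx
      show (fun _ : Fin 1 => (1 - x 0) / 2) ∈ Lset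
      exact ⟨by simp only; linarith [hx.2], by simp only; linarith [hx.1]⟩
    · intro y hy
      have hy' : 0 < y 0 ∧ y 0 < 1 / 2 := hy
      refine ⟨fun _ => 1 - 2 * y 0, ?_, ?_⟩
      · rw [hqRep_domain, mem_ivSet]; constructor <;> linarith [hy'.1, hy'.2]
      · funext i; fin_cases i; simp
  · show (hqRep (w/2)).integrand x = (arcRep w).integrand (fun _ => (1 - x 0) / 2) * |-((1:ℝ) / 2)|
    rw [hqRep_integrand, arcRep_integrand, two_gq_half', abs_neg,
      abs_of_pos (by norm_num : (0:ℝ) < 1 / 2)]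
    have : (0:ℝ) < 1 + x 0 ^ 2 := by positivity
    push_cast
    field_simp

/-- **The arc bridge: `[arcRep w] − [hqRep w] ∈ KZ.relations`** (cut at `1/2`, two affine charts, one
additivity). [KontsevichZagier2001 §1.2; this node] -/
theorem of_arcRep_sub_of_hqRep_mem_relations (w : ℚ) :
    KZ.of (arcRep w) - KZ.of (hqRep w) ∈ KZ.relations := by
  have d1 := cut1 w
  have d2 := cut2 w
  have d3 := arcP_mem w
  have cR := chartR w
  have cL := chartL w
  have ha : KZ.of (hqRep w) - KZ.of (hqRep (w/2)) - KZ.of (hqRep (w/2)) ∈ KZ.relations := by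
    simpa using of_hqRep_add (w/2) (w/2)
  have e : KZ.of (arcRep w) - KZ.of (hqRep w) =
      (KZ.of (arcRep w) - KZ.of (arcL w) - KZ.of (arcM w)) +
      (KZ.of (arcM w) - KZ.of (arcP w) - KZ.of (arcR w)) + KZ.of (arcP w) -
      (KZ.of (hqRep (w/2)) - KZ.of (arcR w)) - (KZ.of (hqRep (w/2)) - KZ.of (arcL w)) -
      (KZ.of (hqRep w) - KZ.of (hqRep (w/2)) - KZ.of (hqRep (w/2))) := by abel
  rw [e]
  exact sub_mem (sub_mem (sub_mem (add_mem (add_mem d1 d2) d3) cR) cL) ha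

/-- Descent INTO `Π` through the arc: anything equivalent to an `arcRep w` lands on the generator
`hqRep w` of the `π`-polynomial sector. [this node] -/
theorem exists_pi_of_sub_arcRep {x : KZ.FormalRep} {w : ℚ} (h : x - KZ.of (arcRep w) ∈ KZ.relations) :
    ∃ y ∈ AddSubgroup.closure piGens, x - y ∈ KZ.relations :=
  ⟨KZ.of (hqRep w), AddSubgroup.subset_closure (of_hqRep_mem_piGens w), by
    have e : x - KZ.of (hqRep w) = (x - KZ.of (arcRep w)) + (KZ.of (arcRep w) - KZ.of (hqRep w)) := by
      abel
    rw [e]; exact add_mem h (of_arcRep_sub_of_hqRep_mem_relations w)⟩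

end Summit.KontsevichZagierPeriods.RootDecompWalshStrata.PiSector

end
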